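import Summits.AtomisticToContinuum.Crystallization.Theorems.FrustratedLawDichotomyStrainedPatchHomConvexCurvature

/-!
# Curvature-sum floor from SIGN-VERTEX matrices with an EXACT `3 × 3` LDLᵀ test (replaces unweighted Gershgorin in the `λ`-leaf of lever (C))

decomp-a2c hand-1 g27 (crux `AperiodicFrustratedLawGap`, stmt-AtomisticToContinuum-27623; `(H) HomFloor (1/625)`, hcp half; lever (C), critic rows
1040 (b) / 1044 / 1050 (C)).  `…HomConvexCurvature.curvatureSum_ge_of_enclosure` certifies `λ‖Δ‖² ≤ Σ_b (α_b⟪c_b,Δ⟫² + β_b‖Δ‖²)` from entrywise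
enclosures of the `3 × 3` Hessian by the UNWEIGHTED Gershgorin row test.  Measured (hand-1 g27 FINDING, `lip/hertz.py`): under strain the centre
Hessian acquires soft–stiff off-diagonal entries and the row test loses `2 / 6 / 13` units of `λ` at entry scales `.010 / .025 / .050` even on an
exact matrix.  This file gives the lossless replacement used by the centred (Lipschitz-Hessian) leaf:

* §1 `quadForm3_nonneg_of_minors` — LDLᵀ / Sylvester for a symmetric `3 × 3` array: `m₁ > 0`, `m₂ > 0`, `m₃ ≥ 0` ⟹ the form is `≥ 0`
  (one polynomial identity);
* §2 `quadForm_ge_of_signVertices` — SIGN-VERTEX REDUCTION (Rohn / Hertz): if for each of the eight sign vectors `z ∈ {±1}³` the vertex array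
  `C − (z zᵀ) ∘ R − κ·1` has non-negative form, then EVERY array `N` with `|N − C| ≤ R` entrywise has form `≥ κ‖x‖²` (take `z = sgn x`:
  `Σ (N−C)_ij x_i x_j ≥ −Σ R_ij |x_i||x_j| = −Σ R_ij z_i z_j x_i x_j`);
* §3 ★★★ `curvatureSum_ge_of_signVertices` — the label-sum form: the matrix part `M_ij = Σ_b (α_b (c_b)_i (c_b)_j + [i=j] β_b)` PLUS an arbitrary
  perturbation array `P` (the first-order terms of the centred leaf), jointly within `R` of the centre data `C`, give
  `κ‖Δ‖² ≤ Σ_b (α_b⟪c_b,Δ⟫² + β_b‖Δ‖²) + Σ_ij P_ij Δ_i Δ_j`.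

NO definitions; 0 sorry; standard axioms; no instances / notation / `#eval`.  `--supports stmt-AtomisticToContinuum-27623`.
-/

noncomputable section

namespace Summit.AtomisticToContinuum.Crystallization.Theorems.FrustratedLawDichotomyStrainedPatchHomHertz

open scoped BigOperators RealInnerProductSpace
open Summit.AtomisticToContinuum.Crystallization.Theorems.FrustratedLawDichotomyStrainedPatchHomConvexCurvature
  (norm_sq_eq_sum rankOne_term_eq_sum segGd_eq_rankOne)
open Summit.AtomisticToContinuum.Crystallization.Theorems.FrustratedLawDichotomyStrainedPatchTaylorChord (segR segGd)

/-! ## §1. LDLᵀ for a symmetric `3 × 3` array -/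

/-- The quadratic form of a symmetric `3 × 3` array through its six independent entries. [arithmetic] -/
theorem quadForm3_eq (M : Fin 3 → Fin 3 → ℝ) (hsym : ∀ i j, M i j = M j i) (x : Fin 3 → ℝ) :
    ∑ i, ∑ j, M i j * (x i * x j) =
      M 0 0 * x 0 ^ 2 + M 1 1 * x 1 ^ 2 + M 2 2 * x 2 ^ 2 + 2 * M 0 1 * (x 0 * x 1) + 2 * M 0 2 * (x 0 * x 2) +
        2 * M 1 2 * (x 1 * x 2) := by
  simp only [Fin.sum_univ_three]
  rw [hsym 1 0, hsym 2 0, hsym 2 1]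
  ring

/-- ★ **LDLᵀ / Sylvester for `3 × 3`**: a symmetric array with leading minors `m₁ = M₀₀ > 0`, `m₂ = M₀₀M₁₁ − M₀₁² > 0` and `m₃ = det M ≥ 0` has
non-negative quadratic form, by the identity `m₁m₂·xᵀMx = m₂(M₀₀x₀ + M₀₁x₁ + M₀₂x₂)² + (m₂x₁ + (M₀₀M₁₂ − M₀₁M₀₂)x₂)² + m₁m₃x₂²`. [folklore] -/
theorem quadForm3_nonneg_of_minors (M : Fin 3 → Fin 3 → ℝ) (hsym : ∀ i j, M i j = M j i) (h1 : 0 < M 0 0)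
    (h2 : 0 < M 0 0 * M 1 1 - M 0 1 ^ 2)
    (h3 : 0 ≤ M 0 0 * (M 1 1 * M 2 2 - M 1 2 ^ 2) - M 0 1 * (M 0 1 * M 2 2 - M 1 2 * M 0 2) + M 0 2 * (M 0 1 * M 1 2 - M 1 1 * M 0 2))
    (x : Fin 3 → ℝ) : 0 ≤ ∑ i, ∑ j, M i j * (x i * x j) := by
  rw [quadForm3_eq M hsym x]
  have hid : M 0 0 * (M 0 0 * M 1 1 - M 0 1 ^ 2) *
      (M 0 0 * x 0 ^ 2 + M 1 1 * x 1 ^ 2 + M 2 2 * x 2 ^ 2 + 2 * M 0 1 * (x 0 * x 1) + 2 * M 0 2 * (x 0 * x 2) + 2 * M 1 2 * (x 1 * x 2)) =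
      (M 0 0 * M 1 1 - M 0 1 ^ 2) * (M 0 0 * x 0 + M 0 1 * x 1 + M 0 2 * x 2) ^ 2 +
        ((M 0 0 * M 1 1 - M 0 1 ^ 2) * x 1 + (M 0 0 * M 1 2 - M 0 1 * M 0 2) * x 2) ^ 2 +
        M 0 0 * (M 0 0 * (M 1 1 * M 2 2 - M 1 2 ^ 2) - M 0 1 * (M 0 1 * M 2 2 - M 1 2 * M 0 2) + M 0 2 * (M 0 1 * M 1 2 - M 1 1 * M 0 2)) *
          x 2 ^ 2 := by
    ring
  have hrhs : 0 ≤ (M 0 0 * M 1 1 - M 0 1 ^ 2) * (M 0 0 * x 0 + M 0 1 * x 1 + M 0 2 * x 2) ^ 2 +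
        ((M 0 0 * M 1 1 - M 0 1 ^ 2) * x 1 + (M 0 0 * M 1 2 - M 0 1 * M 0 2) * x 2) ^ 2 +
        M 0 0 * (M 0 0 * (M 1 1 * M 2 2 - M 1 2 ^ 2) - M 0 1 * (M 0 1 * M 2 2 - M 1 2 * M 0 2) + M 0 2 * (M 0 1 * M 1 2 - M 1 1 * M 0 2)) *
          x 2 ^ 2 :=
    add_nonneg (add_nonneg (mul_nonneg h2.le (sq_nonneg _)) (sq_nonneg _)) (mul_nonneg (mul_nonneg h1.le h3) (sq_nonneg _))
  have hpos : 0 < M 0 0 * (M 0 0 * M 1 1 - M 0 1 ^ 2) := mul_pos h1 h2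
  have hle : M 0 0 * (M 0 0 * M 1 1 - M 0 1 ^ 2) * 0 ≤ M 0 0 * (M 0 0 * M 1 1 - M 0 1 ^ 2) *
      (M 0 0 * x 0 ^ 2 + M 1 1 * x 1 ^ 2 + M 2 2 * x 2 ^ 2 + 2 * M 0 1 * (x 0 * x 1) + 2 * M 0 2 * (x 0 * x 2) + 2 * M 1 2 * (x 1 * x 2)) := by
    rw [mul_zero, hid]; exact hrhs
  exact le_of_mul_le_mul_left hle hpos

/-! ## §2. The sign-vertex reduction -/

/-- The sign vector of `x`: `z_i = 1` if `x_i ≥ 0`, else `−1`; `z_i x_i = |x_i|`. [arithmetic] -/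
theorem sign_mul_eq_abs (x : Fin 3 → ℝ) (i : Fin 3) : (if 0 ≤ x i then (1 : ℝ) else -1) * x i = |x i| := by
  split_ifs with h
  · rw [one_mul, abs_of_nonneg h]
  · rw [abs_of_neg (lt_of_not_ge h)]; ring

/-- ★ **Entrywise perturbation bound through the sign vector**: `|P_ij| ≤ R_ij` ⟹ `Σ P_ij x_i x_j ≥ −Σ R_ij (z_i z_j)(x_i x_j)` for `z = sgn x`. [folklore] -/
theorem quadForm_pert_ge (P R : Fin 3 → Fin 3 → ℝ) (hP : ∀ i j, |P i j| ≤ R i j) (x : Fin 3 → ℝ) :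
    -(∑ i, ∑ j, R i j * ((if 0 ≤ x i then (1 : ℝ) else -1) * (if 0 ≤ x j then (1 : ℝ) else -1)) * (x i * x j)) ≤
      ∑ i, ∑ j, P i j * (x i * x j) := by
  rw [← Finset.sum_neg_distrib]
  refine Finset.sum_le_sum fun i _ => ?_
  rw [← Finset.sum_neg_distrib]
  refine Finset.sum_le_sum fun j _ => ?_
  have hz : R i j * ((if 0 ≤ x i then (1 : ℝ) else -1) * (if 0 ≤ x j then (1 : ℝ) else -1)) * (x i * x j) = R i j * (|x i| * |x j|) := by
    rw [← sign_mul_eq_abs x i, ← sign_mul_eq_abs x j]; ring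
  rw [hz]
  have h1 : |P i j * (x i * x j)| ≤ R i j * (|x i| * |x j|) := by
    rw [abs_mul, abs_mul]
    exact mul_le_mul_of_nonneg_right (hP i j) (mul_nonneg (abs_nonneg _) (abs_nonneg _))
  linarith [neg_abs_le (P i j * (x i * x j))]

/-- ★★ **SIGN-VERTEX REDUCTION** (Rohn / Hertz).  Centre data `C`, radius data `R`, constant `κ`.  If for each sign vector `z ∈ {±1}³` the vertex
array `V_z = C − (z zᵀ) ∘ R − κ·1` has non-negative form, then every array `N` with `|N_ij − C_ij| ≤ R_ij` satisfies `κ·Σ x_i² ≤ Σ N_ij x_i x_j`.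
[folklore: Rohn 1994 / Hertz 1992, elementary direction] -/
theorem quadForm_ge_of_signVertices (C R : Fin 3 → Fin 3 → ℝ) {κ : ℝ}
    (hV : ∀ z : Fin 3 → ℝ, (∀ i, z i = 1 ∨ z i = -1) →
      ∀ x : Fin 3 → ℝ, 0 ≤ ∑ i, ∑ j, (C i j - z i * z j * R i j - if i = j then κ else 0) * (x i * x j))
    (N : Fin 3 → Fin 3 → ℝ) (hN : ∀ i j, |N i j - C i j| ≤ R i j) (x : Fin 3 → ℝ) :
    κ * ∑ i, x i ^ 2 ≤ ∑ i, ∑ j, N i j * (x i * x j) := by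
  set z : Fin 3 → ℝ := fun i => if 0 ≤ x i then (1 : ℝ) else -1 with hz
  have hzs : ∀ i, z i = 1 ∨ z i = -1 := by
    intro i; simp only [hz]; split_ifs <;> simp
  have hpert := quadForm_pert_ge (fun i j => N i j - C i j) R hN x
  have hvert := hV z hzs x
  -- `Σ N x x = Σ C x x + Σ (N − C) x x`
  have hsplit : ∑ i, ∑ j, N i j * (x i * x j) = ∑ i, ∑ j, C i j * (x i * x j) + ∑ i, ∑ j, (N i j - C i j) * (x i * x j) := by
    rw [← Finset.sum_add_distrib]
    refine Finset.sum_congr rfl fun i _ => ?_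
    rw [← Finset.sum_add_distrib]
    exact Finset.sum_congr rfl fun j _ => by ring
  -- the vertex form splits as `Σ C x x − Σ R z z x x − κ Σ x²`
  have hvsplit : ∑ i, ∑ j, (C i j - z i * z j * R i j - if i = j then κ else 0) * (x i * x j) =
      ∑ i, ∑ j, C i j * (x i * x j) - ∑ i, ∑ j, R i j * (z i * z j) * (x i * x j) - κ * ∑ i, x i ^ 2 := by
    have hdiag : ∀ i : Fin 3, ∑ j, (if i = j then κ else 0) * (x i * x j) = κ * x i ^ 2 := by
      intro i
      rw [Finset.sum_eq_single i]
      · simp [sq]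
      · intro j _ hji; simp [Ne.symm hji]
      · intro h; exact absurd (Finset.mem_univ i) h
    rw [Finset.mul_sum, ← Finset.sum_sub_distrib, ← Finset.sum_sub_distrib]
    refine Finset.sum_congr rfl fun i _ => ?_
    rw [← hdiag i, ← Finset.sum_sub_distrib, ← Finset.sum_sub_distrib]
    exact Finset.sum_congr rfl fun j _ => by ring
  rw [hvsplit] at hvert
  rw [hsplit]
  have hpert' : -(∑ i, ∑ j, R i j * (z i * z j) * (x i * x j)) ≤ ∑ i, ∑ j, (N i j - C i j) * (x i * x j) := by
    simpa [hz] using hpert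
  linarith

/-! ## §3. ★★★ The curvature-sum floor with a perturbation array -/

/-- ★★★ **CURVATURE-SUM FLOOR FROM SIGN-VERTEX TESTS** (matrix part + perturbation).  Labels `b ∈ B` with `α_b, β_b, c_b`; put
`M_ij = Σ_b (α_b (c_b)_i (c_b)_j + [i=j] β_b)`; let `P` be any array (the centred leaf's first-order terms) with `|M_ij + P_ij − C_ij| ≤ R_ij`.
If every sign-vertex array `C − (z zᵀ) ∘ R − κ·1` has non-negative form then, for every `Δ`,
`κ‖Δ‖² ≤ Σ_b (α_b⟪c_b,Δ⟫² + β_b‖Δ‖²) + Σ_ij P_ij Δ_i Δ_j`. [folklore chaining: §2 + `…HomConvexCurvature.rankOne_term_eq_sum`] -/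
theorem curvatureSum_ge_of_signVertices {ι : Type*} (B : Finset ι) (α β : ι → ℝ) (c : ι → EuclideanSpace ℝ (Fin 3))
    (P C R : Fin 3 → Fin 3 → ℝ) {κ : ℝ}
    (hV : ∀ z : Fin 3 → ℝ, (∀ i, z i = 1 ∨ z i = -1) →
      ∀ x : Fin 3 → ℝ, 0 ≤ ∑ i, ∑ j, (C i j - z i * z j * R i j - if i = j then κ else 0) * (x i * x j))
    (hN : ∀ i j, |(∑ b ∈ B, (α b * (c b i * c b j) + (if i = j then β b else 0))) + P i j - C i j| ≤ R i j)
    (Δ : EuclideanSpace ℝ (Fin 3)) :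
    κ * ‖Δ‖ ^ 2 ≤ (∑ b ∈ B, (α b * ⟪c b, Δ⟫ ^ 2 + β b * ‖Δ‖ ^ 2)) + ∑ i, ∑ j, P i j * (Δ i * Δ j) := by
  set N : Fin 3 → Fin 3 → ℝ := fun i j => (∑ b ∈ B, (α b * (c b i * c b j) + (if i = j then β b else 0))) + P i j with hNdef
  have key := quadForm_ge_of_signVertices C R hV N (fun i j => hN i j) (fun i => Δ i)
  have hexp : (∑ b ∈ B, (α b * ⟪c b, Δ⟫ ^ 2 + β b * ‖Δ‖ ^ 2)) + ∑ i, ∑ j, P i j * (Δ i * Δ j) = ∑ i, ∑ j, N i j * (Δ i * Δ j) := by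
    have h1 : ∑ b ∈ B, (α b * ⟪c b, Δ⟫ ^ 2 + β b * ‖Δ‖ ^ 2) =
        ∑ i, ∑ j, (∑ b ∈ B, (α b * (c b i * c b j) + (if i = j then β b else 0))) * (Δ i * Δ j) := by
      calc ∑ b ∈ B, (α b * ⟪c b, Δ⟫ ^ 2 + β b * ‖Δ‖ ^ 2)
          = ∑ b ∈ B, ∑ i, ∑ j, (α b * (c b i * c b j) + (if i = j then β b else 0)) * (Δ i * Δ j) :=
            Finset.sum_congr rfl fun b _ => rankOne_term_eq_sum (α b) (β b) (c b) Δ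
        _ = ∑ i, ∑ b ∈ B, ∑ j, (α b * (c b i * c b j) + (if i = j then β b else 0)) * (Δ i * Δ j) := Finset.sum_comm
        _ = ∑ i, ∑ j, ∑ b ∈ B, (α b * (c b i * c b j) + (if i = j then β b else 0)) * (Δ i * Δ j) :=
            Finset.sum_congr rfl fun i _ => Finset.sum_comm
        _ = ∑ i, ∑ j, (∑ b ∈ B, (α b * (c b i * c b j) + (if i = j then β b else 0))) * (Δ i * Δ j) :=
            Finset.sum_congr rfl fun i _ => Finset.sum_congr rfl fun j _ => by rw [Finset.sum_mul]
    rw [h1, ← Finset.sum_add_distrib]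
    refine Finset.sum_congr rfl fun i _ => ?_
    rw [← Finset.sum_add_distrib]
    exact Finset.sum_congr rfl fun j _ => by simp only [hNdef]; ring
  rw [hexp, norm_sq_eq_sum]
  exact key

/-- ★★★ **… in the `segGd` language of the segment lemma** (cf. `…HomConvexCurvature.segGd_sum_ge_of_enclosure`): at a parameter `s` with all radii
`ρ_b = ‖p_b + sΔ′‖ ≠ 0`, `κ‖Δ‖² ≤ Σ_b segGd W₁ p_b Δ′ s`-type floors follow by rewriting each `segGd` with `segGd_eq_rankOne`; recorded here for the
direction `Δ′ = Δ` used by `hcpShifted_floor_W45`, WITHOUT perturbation (`P = 0`): the drop-in replacement of the Gershgorin row test. [folklore chaining] -/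
theorem segGd_sum_ge_of_signVertices {ι : Type*} (B : Finset ι) (W₁ : ℝ → ℝ) (p : ι → EuclideanSpace ℝ (Fin 3))
    (Δ : EuclideanSpace ℝ (Fin 3)) {s : ℝ}
    (h0 : ∀ b ∈ B, segR (p b) Δ s ≠ 0)
    (C R : Fin 3 → Fin 3 → ℝ) {κ : ℝ}
    (hV : ∀ z : Fin 3 → ℝ, (∀ i, z i = 1 ∨ z i = -1) →
      ∀ x : Fin 3 → ℝ, 0 ≤ ∑ i, ∑ j, (C i j - z i * z j * R i j - if i = j then κ else 0) * (x i * x j))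
    (hN : ∀ i j, |(∑ b ∈ B,
      ((deriv W₁ (segR (p b) Δ s) -
          W₁ (segR (p b) Δ s) /
            segR (p b) Δ s) /
          segR (p b) Δ s ^ 2 *
          ((p b + s • Δ) i * (p b + s • Δ) j) +
        (if i = j then W₁ (segR (p b) Δ s) /
          segR (p b) Δ s else 0))) - C i j| ≤ R i j) :
    κ * ‖Δ‖ ^ 2 ≤ ∑ b ∈ B, segGd W₁ (p b) Δ s := by
  have key := curvatureSum_ge_of_signVertices B
    (fun b => (deriv W₁ (segR (p b) Δ s) -
      W₁ (segR (p b) Δ s) /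
        segR (p b) Δ s) /
      segR (p b) Δ s ^ 2)
    (fun b => W₁ (segR (p b) Δ s) /
      segR (p b) Δ s)
    (fun b => p b + s • Δ) (fun _ _ => 0) C R hV (fun i j => by simpa using hN i j) Δ
  simp only [zero_mul, Finset.sum_const_zero, add_zero] at key
  refine key.trans (le_of_eq ?_)
  exact Finset.sum_congr rfl fun b hb => (segGd_eq_rankOne W₁ (p b) Δ (h0 b hb)).symm

end Summit.AtomisticToContinuum.Crystallization.Theorems.FrustratedLawDichotomyStrainedPatchHomHertz

end
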